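import Summits.Ventures.PercRepro.ProfilePointedCircuitClassesInOutColoop

/-!
# PercRepro — `InOutBottomFour` REDUCES TO THE TWIN-FREE POINTS (p5, gen 37; §53 ADDENDA 1, 6)

`inOutBottomFour_of_twinFree`: if `in_4(e) ≤ out_5(e)` holds on every nullity-4 matroid at every point `e` that is
neither a loop nor a coloop and has no parallel twin, then `InOutBottomFour α` holds — the loop, coloop and twin
cases being theorems (`inCount_four_le_outCount_five_of_loop`, `…_of_coloop`, `…_of_parallel`).  So the only open
piece of the nullity-5 chain (`thresholdIneq_six_top_of_nullity_le_five_of_inout`) is the in–out inequality at the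
twin-free points.
-/

open scoped Matroid

namespace PercRepro.Cogirth

open Finset ThmH Skew Shadow Profile

variable {α : Type} [DecidableEq α]

section InOutReduce

/-- **THE REDUCTION OF `InOutBottomFour` TO THE TWIN-FREE POINTS**: the loop, coloop and parallel-twin cases are theorems,
so the conjecture holds as soon as it holds at every point `e` with `ρ{e} = 1`, `ρ(E − e) = ρ(E)` and no `f ≠ e`
with `ρ{f} = 1`, `f ∈ cl{e}`. -/
theorem inOutBottomFour_of_twinFree
    (h : ∀ (N : Matroid α) [N.Finite] (e : α), e ∈ gr N → (gr N).card = rk N (gr N) + 4 → 6 ≤ rk N (gr N) →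
      rk N {e} = 1 → rk N ((gr N).erase e) = rk N (gr N) →
      (∀ f ∈ gr N, f ≠ e → rk N {f} = 1 → f ∉ clF N {e}) → inCount N 4 e ≤ outCount N 5 e) :
    InOutBottomFour α := by
  intro N _ e he hn hR
  -- loop?
  by_cases hl : rk N {e} = 0
  · exact inCount_four_le_outCount_five_of_loop hl
  have hre : rk N {e} = 1 := by
    have := rk_le_card (M := N) {e}
    rw [card_singleton] at this
    omega
  -- coloop?
  by_cases hco : rk N ((gr N).erase e) < rk N (gr N)
  · exact inCount_four_le_outCount_five_of_coloop hn hco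
  have hnc : rk N ((gr N).erase e) = rk N (gr N) := by
    have := rk_le_rk_of_subset_finset (M := N) (erase_subset e (gr N))
    omega
  -- twin?
  by_cases htw : ∃ f ∈ gr N, f ≠ e ∧ rk N {f} = 1 ∧ f ∈ clF N {e}
  · obtain ⟨f, hf, hfe, hrf, hfcl⟩ := htw
    exact inCount_four_le_outCount_five_of_parallel hn hR (fun h' => hfe h'.symm) he hf hre hrf hfcl
  · exact h N e he hn hR hre hnc (fun f hf hfe hrf hfcl => htw ⟨f, hf, hfe, hrf, hfcl⟩)

end InOutReduce

end PercRepro.Cogirth
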